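import Mathlib
import HarnessLib
import Literature.Analysis.FluidPDE.ClassicalSolution
import Literature.Analysis.FluidPDE.ClassicalSolutionRescale
import Literature.Analysis.FluidPDE.WholeSpaceIBP
import Literature.Analysis.FunctionSpaces.SobolevDomain
import Literature.Analysis.FunctionSpaces.TorusTestFunction
import Literature.Analysis.FluidPDE.StirringCell
import Literature.Analysis.FluidPDE.EulerReynoldsDilation
import Literature.Analysis.FluidPDE.EulerReynoldsTorusScaffold

/-!
# Stub `stub_tunedTorusPlanting` of the line `Sketch` (crux stmt-AnomalousDissipation-19035,
# `PointSink.SolitonTransplant`): the tuned torus planting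

Registered signature (proved here, textually; `E³ = EuclideanSpace ℝ (Fin 3)`, `𝕋³ = UnitAddTorus (Fin 3)`
are the skeleton's local notations, redeclared below):
```
theorem stub_tunedTorusPlanting :
    ∀ (lam : ℝ) (V : E³ → E³), 1 < lam →
      (∀ x : E³, x ≠ 0 → V (lam • x) = lam ^ (-(2 / 3 : ℝ)) • V x) →
      ∀ (r₀ r₁ c : ℝ) (U : E³ → E³) (R : E³ → Fin 3 → Fin 3 → ℝ),
        (0 < r₀ ∧ r₀ < r₁ ∧ 0 < c) →
        (∀ x : E³, 0 < ‖x‖ → ‖x‖ < r₀ → U x = V x) →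
        (∀ x : E³, ‖x‖ ≤ r₀ → R x = 0) →
        (∀ x : E³, r₁ ≤ ‖x‖ → U x = 0 ∧ R x = fun i j => if i = j then c else 0) →
        ContDiffOn ℝ ∞ U {x : E³ | r₀ < ‖x‖} → ContDiffOn ℝ ∞ R {x : E³ | r₀ < ‖x‖} →
        (∀ x : E³, r₀ < ‖x‖ → (Matrix.of (R x)).PosDef) →
        (MemLp U 2 volume ∧ IntegrableOn R (ball (0 : E³) r₁) volume) →
        (∀ θ : E³ → ℝ, ContDiff ℝ ∞ θ → HasCompactSupport θ → ∫ x, ⟪U x, gradient θ x⟫_ℝ = 0) →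
        (∀ w : E³ → E³, IsTestFunctionOn ⟨{x : E³ | x ≠ 0}, isOpen_ne⟩ w →
          (∀ x, VectorCalculus.divergence w x = 0) →
          ∫ x, (⟪U x, fderiv ℝ w x (U x)⟫_ℝ +
            ∑ i, ∑ j, R x i j * fderiv ℝ w x (EuclideanSpace.single j 1) i) = 0) →
      ∀ D : ℝ, 0 < D →
      ∃ (x₀ : 𝕋³) (r₀' r₁' : ℝ) (f U' : 𝕋³ → E³) (R' : 𝕋³ → Fin 3 → Fin 3 → ℝ), … (the eleven
        scaffold clauses, see the theorem) … ∧ ∫ x, ⟪f x, U' x⟫_ℝ = D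
```
TUNED TORUS PLANTING. From a zero-force free-space sink completion `(r₀, r₁, c, U, R)` of the
discretely self-similar germ `V` (`V(λx) = λ^{-2/3}V(x)` off `0`) and a power target `D > 0`, the
torus scaffold of the line with prescribed power `∫⟪f, U'⟫ = D` is built in three landed steps:
(A) DILATION (`Literature.Analysis.FluidPDE.sinkCompletion_rescale`, `EulerReynoldsDilation`): the
rescaled data `(r₀/μ, r₁/μ, cμ^{4/3}, μ^{2/3}U(μ·), μ^{4/3}R(μ·))`, `μ = λ^m`, is again a sink
completion of the SAME germ (self-similarity), and `m` is chosen (`tunedTorusPlanting_scale`,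
Archimedes) with `r₁/μ ≤ 1/16` and ambient level `cμ^{4/3}` above the cell's threshold;
(B) the EXPLICIT STIRRING CELL (`Literature.Analysis.FluidPDE.exists_stirringCell`,
`StirringCell`): a compactly supported smooth strict Euler–Reynolds subsolution `(W, c·Id + S)` with
smooth divergence-free source `f` and power exactly `D`, planar field `W = ∂₁ψe₀ − ∂₀ψe₁`,
`S = κ(∇W + ∇Wᵀ) − W⊗W`, `f = κΔW`, placed in `B(p, 1/16)`, `p = (⅛, ½, ½)`
(`tunedTorusPlanting_cell`, coordinates); (C) PLANTING
(`Literature.Analysis.FluidPDE.exists_eulerReynolds_torusScaffold`, `EulerReynoldsTorusScaffold`):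
periodise `U(· − q) + W`, `(R(· − q) − c·Id) + S`, `f` from the unit cube centred at
`q = (½, ½, ½)`, sink `x₀ = proj q`; the weak identity against torus tests is localised on the
sink by the tree's divergence-free truncation (`SolenoidalTruncation`) and on the cell by a scalar
cut-off. Pure proof file (no definitions). [folklore]
-/

-- `Summit.<Summit>.<Problem>` is the tree's mandated summit-side namespace (CONVENTIONS §2); for this
-- single-conjunct summit the two coincide, so the duplicate is deliberate.
set_option linter.dupNamespace false

noncomputable section

namespace Summit.AnomalousDissipation.AnomalousDissipation.Theorems

open MeasureTheory Filter Topology Set Metric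
open scoped InnerProductSpace ContDiff Laplacian
open Literature.Analysis.FunctionSpaces Literature.Analysis.FluidPDE

/-- Physical space `ℝ³` (local notation, as in the registered skeleton). -/
local notation "E³" => EuclideanSpace ℝ (Fin 3)
/-- The flat three-torus (local notation, as in the registered skeleton). -/
local notation "𝕋³" => UnitAddTorus (Fin 3)

/-- **The stirring cell in coordinates.** The landed cell `exists_stirringCell` for the standard
frame of `ℝ³` (indices `0 ≠ 1`), centre `p`, radius `1/16`, power `D`, with its weak identity
rewritten in coordinates (`⟪eᵢ, Dφ eⱼ⟫ = (Dφ eⱼ)ᵢ`, `eⱼ = EuclideanSpace.single j 1`). [folklore] -/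
theorem tunedTorusPlanting_cell (D : ℝ) (hD : 0 < D) (p : E³) :
    ∃ (c₀ : ℝ) (W f : E³ → E³) (S : E³ → Fin 3 → Fin 3 → ℝ),
      ContDiff ℝ ∞ W ∧ ContDiff ℝ ∞ f ∧ ContDiff ℝ ∞ S ∧
      tsupport W ⊆ ball p (1 / 16) ∧ tsupport f ⊆ ball p (1 / 16) ∧ tsupport S ⊆ ball p (1 / 16) ∧
      (∀ x, VectorCalculus.divergence W x = 0) ∧ (∀ x, VectorCalculus.divergence f x = 0) ∧
      (∀ c, c₀ ≤ c → 0 < c ∧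
        ∀ x, (Matrix.of fun i j => (if i = j then c else 0) + S x i j).PosDef) ∧
      (∀ φ : E³ → E³, ContDiff ℝ ∞ φ → HasCompactSupport φ →
        ∫ x, (⟪W x, fderiv ℝ φ x (W x)⟫_ℝ +
          ∑ i, ∑ j, S x i j * fderiv ℝ φ x (EuclideanSpace.single j 1) i + ⟪f x, φ x⟫_ℝ) = 0) ∧
      ∫ x, ⟪f x, W x⟫_ℝ = D := by
  obtain ⟨c₀, W, f, S, hW, hf, hS, hWs, hfs, hSs, hWd, hfd, hpos, hcell, hpow⟩ :=
    exists_stirringCell (EuclideanSpace.basisFun (Fin 3) ℝ) (i₀ := 0) (i₁ := 1) (by decide) p hD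
      (by norm_num : (0 : ℝ) < 1 / 16)
  refine ⟨c₀, W, f, S, hW, hf, hS, hWs, hfs, hSs, hWd, hfd, hpos, fun φ hφ hφc => ?_, hpow⟩
  have h := hcell φ hφ hφc
  simp only [EuclideanSpace.basisFun_inner] at h
  simpa only [EuclideanSpace.basisFun_apply] using h

/-- **Choice of the scale.** For `λ > 1` there is `m` with `r₁/λ^m ≤ 1/16` and
`c₀ ≤ c (λ^m)^{4/3}` (`c > 0`, any real `r₁`, `c₀`): Archimedes (`pow_unbounded_of_one_lt`) and `t ≤ t^{4/3}` for
`t ≥ 1`. [folklore] -/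
theorem tunedTorusPlanting_scale {lam c : ℝ} (r₁ c₀ : ℝ) (hlam : 1 < lam) (hc : 0 < c) : ∃ m : ℕ, r₁ / lam ^ m ≤ 1 / 16 ∧ c₀ ≤ c * (lam ^ m) ^ (4 / 3 : ℝ) := by
  obtain ⟨m, hm⟩ := pow_unbounded_of_one_lt (max (16 * r₁) (max 1 (c₀ / c))) hlam
  have hpow : 0 < lam ^ m := pow_pos (one_pos.trans hlam) m
  have h16 : 16 * r₁ < lam ^ m := lt_of_le_of_lt (le_max_left _ _) hm
  have h1 : 1 < lam ^ m := lt_of_le_of_lt ((le_max_left _ _).trans (le_max_right _ _)) hm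
  have hcc : c₀ / c < lam ^ m := lt_of_le_of_lt ((le_max_right _ _).trans (le_max_right _ _)) hm
  refine ⟨m, ?_, ?_⟩
  · rw [div_le_iff₀ hpow]
    linarith
  · have h2 : lam ^ m ≤ (lam ^ m) ^ (4 / 3 : ℝ) := by
      conv_lhs => rw [← Real.rpow_one (lam ^ m)]
      exact Real.rpow_le_rpow_of_exponent_le h1.le (by norm_num)
    have h3 : c₀ < c * lam ^ m := by rwa [div_lt_iff₀' hc] at hcc
    nlinarith

/-- **S5b `stub_tunedTorusPlanting`.** TUNED TORUS PLANTING: from a free-space sink completion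
`(r₀, r₁, c, U, R)` of the DSS cone `V` and a power target `D > 0`, the torus SCAFFOLD of the line
with PRESCRIBED POWER `∫⟪f, U'⟫ = D` — radii `0 < r₀' < r₁' ≤ 1/4`; `f` smooth, divergence free,
mean zero, `≡ 0` on `B_{r₁'}(x₀)`; `U' = V` on the punctured germ ball; `R' = 0` on the closed germ
ball; `U'`, `R'` smooth and `R' ≻ 0` on the outer set; `U' ∈ L²(T³)`, `R' ∈ L¹`, `U'` weakly
divergence free; weak Euler–Reynolds subsolution with source `f` off the sink; plus the power
clause. Proof: dilate the completion by `λ^{-m}` (`sinkCompletion_rescale`; the germ is fixed by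
self-similarity, the radii drop below `1/16`, the ambient level `c(λ^m)^{4/3}` rises above the
cell's threshold), take the explicit stirring cell with power `D` at that level
(`exists_stirringCell`), and plant both in `T³` (`exists_eulerReynolds_torusScaffold`). [folklore] -/
theorem stub_tunedTorusPlanting :
    ∀ (lam : ℝ) (V : E³ → E³), 1 < lam →
      (∀ x : E³, x ≠ 0 → V (lam • x) = lam ^ (-(2 / 3 : ℝ)) • V x) →
      ∀ (r₀ r₁ c : ℝ) (U : E³ → E³) (R : E³ → Fin 3 → Fin 3 → ℝ),
        (0 < r₀ ∧ r₀ < r₁ ∧ 0 < c) →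
        (∀ x : E³, 0 < ‖x‖ → ‖x‖ < r₀ → U x = V x) →
        (∀ x : E³, ‖x‖ ≤ r₀ → R x = 0) →
        (∀ x : E³, r₁ ≤ ‖x‖ → U x = 0 ∧ R x = fun i j => if i = j then c else 0) →
        ContDiffOn ℝ ∞ U {x : E³ | r₀ < ‖x‖} → ContDiffOn ℝ ∞ R {x : E³ | r₀ < ‖x‖} →
        (∀ x : E³, r₀ < ‖x‖ → (Matrix.of (R x)).PosDef) →
        (MemLp U 2 volume ∧ IntegrableOn R (ball (0 : E³) r₁) volume) →
        (∀ θ : E³ → ℝ, ContDiff ℝ ∞ θ → HasCompactSupport θ → ∫ x, ⟪U x, gradient θ x⟫_ℝ = 0) →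
        (∀ w : E³ → E³, IsTestFunctionOn ⟨{x : E³ | x ≠ 0}, isOpen_ne⟩ w →
          (∀ x, VectorCalculus.divergence w x = 0) →
          ∫ x, (⟪U x, fderiv ℝ w x (U x)⟫_ℝ +
            ∑ i, ∑ j, R x i j * fderiv ℝ w x (EuclideanSpace.single j 1) i) = 0) →
      ∀ D : ℝ, 0 < D →
      ∃ (x₀ : 𝕋³) (r₀' r₁' : ℝ) (f U' : 𝕋³ → E³) (R' : 𝕋³ → Fin 3 → Fin 3 → ℝ),
        (0 < r₀' ∧ r₀' < r₁' ∧ r₁' ≤ 1 / 4) ∧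
        (Torus.IsSmooth f ∧ Torus.IsDivFree f ∧ Torus.HasZeroMean f) ∧
        (∀ v : E³, ‖v‖ < r₁' → Torus.liftAt f x₀ v = 0) ∧
        (∀ v : E³, 0 < ‖v‖ → ‖v‖ < r₀' → Torus.liftAt U' x₀ v = V v) ∧
        (∀ v : E³, ‖v‖ ≤ r₀' → Torus.liftAt R' x₀ v = 0) ∧
        ContDiffOn ℝ ∞ (Torus.liftAt U' x₀) {v : E³ | ∀ w : E³, Torus.proj w = 0 → r₀' < ‖v - w‖} ∧
        ContDiffOn ℝ ∞ (Torus.liftAt R' x₀) {v : E³ | ∀ w : E³, Torus.proj w = 0 → r₀' < ‖v - w‖} ∧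
        (∀ v : E³, (∀ w : E³, Torus.proj w = 0 → r₀' < ‖v - w‖) →
          (Matrix.of (Torus.liftAt R' x₀ v)).PosDef) ∧
        (MemLp U' 2 volume ∧ Integrable R' volume ∧ Torus.IsWeaklyDivFree U') ∧
        (∀ w : 𝕋³ → E³, Torus.IsSmooth w → Torus.IsDivFree w →
          (∃ δ : ℝ, 0 < δ ∧ ∀ v : E³, ‖v‖ < δ → Torus.liftAt w x₀ v = 0) →
          ∫ x, (⟪U' x, Torus.convect U' w x⟫_ℝ +
            ∑ i, ∑ j, R' x i j * Torus.partialDeriv j w x i + ⟪f x, w x⟫_ℝ) = 0) ∧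
        ∫ x, ⟪f x, U' x⟫_ℝ = D := by
  intro lam V hlam hDSS r₀ r₁ c U R hr hgerm hR0 hrest hUs hRs hpos hint hwdiv hweak D hD
  -- the two centres: the cube centre `q = (½,½,½)` (sink) and the cell centre `p = (⅛,½,½)`
  set q : E³ := WithLp.toLp 2 (fun _ : Fin 3 => (1 / 2 : ℝ)) with hqdef
  set p : E³ := WithLp.toLp 2 (fun i : Fin 3 => if i = 0 then (1 / 8 : ℝ) else 1 / 2) with hpdef
  have hq : ∀ i, q i = 1 / 2 := fun i => by simp [hqdef]
  have hp : ∀ i, p i = if i = 0 then 1 / 8 else 1 / 2 := fun i => by simp [hpdef]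
  -- (B) the explicit stirring cell at `p` with power `D`
  obtain ⟨c₀, W, f, S, hW, hf, hS, hWs, hfs, hSs, hWd, hfd, hposcell, hcell, hpow⟩ :=
    tunedTorusPlanting_cell D hD p
  -- (A) the scale `μ = λ^m` and the dilated completion
  obtain ⟨m, hm₁, hm₂⟩ := tunedTorusPlanting_scale r₁ c₀ hlam hr.2.2
  obtain ⟨hr', hgerm', hR0', hrest', hUs', hRs', hpos', hint', hwdiv', hweak'⟩ :=
    sinkCompletion_rescale lam V hlam hDSS r₀ r₁ c U R hr hgerm hR0 hrest hUs hRs hpos hint hwdiv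
      hweak m
  obtain ⟨-, hScell⟩ := hposcell _ hm₂
  -- (C) plant both in the torus
  exact exists_eulerReynolds_torusScaffold q p hq hp V _ _ (r₀ / lam ^ m) (r₁ / lam ^ m)
    (c * (lam ^ m) ^ (4 / 3 : ℝ)) ⟨hr'.1, hr'.2.1, hm₁⟩ hgerm' hR0' hrest' hUs' hRs' hpos'
    hint' hwdiv' hweak' W f S hW hf hS hWs hfs hSs hWd hfd hScell hcell D hpow

end Summit.AnomalousDissipation.AnomalousDissipation.Theorems

end
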